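import Literature.MathematicalPhysics.QuantumFieldTheory.Balaban1983to89.T4EtaRateDefect
import Literature.MathematicalPhysics.QuantumFieldTheory.Balaban1983to89.T4EtaRateCoeffDefect
import Literature.MathematicalPhysics.QuantumFieldTheory.Balaban1983to89.B6Prop26Gluing
import HarnessLib

/-!
# N15 (NE2), King-model rung (dag-n15-d g20) — THE FIRST-ORDER DRESSED PAIR's η-DEFECT WITH THE JET KEPT ON BOTH GRIDS, AND WITH A FREE SOURCE:
# the closed linear system for the value defect `𝔇₀ = 𝔇(X′, X)` and the gradient defects `𝔇_ν = 𝔇(∇′_νX′, ∇_νX)` (no derivative of a defect, no transport law,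
# no face term), and dag-n15-a II-A's value-only identity re-issued with a free source term (the right-derivative pair `W = X∘∇♯ = G∇♯ + G∘V₁∘W`, entry 2)

Cell `pub-ymgap`, seat `pub-ymgap-dag-n15-d` (R134 N15 NE2 s3, King-model rung), generation 20; architecture note INBOX l.41910 ∕ l.41934, dag-n15-a g24 «GO (o5a)» l.41929
(consumed BY NAME by programme M-III).  `--kind proof --supports stmt-QuantumFields-27366 --as helper` (K3⁸; count-neutral).  Generic carriers; over `T4EtaRateDefect.idef`,
`T4EtaRateCoeffDefect.pull`, `B6Prop26Gluing.mulOp` BY NAME; 0 `def`; nothing in the tree is modified.  Companion of dag-n15-a II-A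
`…N15TwoGridFirstOrderByParts.idef_firstOrder_fix` (p654093: the VALUE-ONLY fixed point with source `= G`, gradient defect eliminated through King's box filter).

WHAT.  Coarse data on `X`: a source `S`, a dressing piece `G`, coefficients `c, a_μ`, the dressed value `X` and jet components `Y_μ` with the (3.65)-shaped fixed point in
JET FORM `X = S + G∘(M_cX + Σ_μ M_{a_μ}Y_μ)`; fine data on `X′` likewise.  §1 ★ `idef_firstOrder_jetValue_fix`: `𝔇₀ = 𝔇(S′,S) + 𝔇(G′,G)∘V + G′∘R` with
`V = M_cX + ΣM_{a_μ}Y_μ` and the COMMON BRACKET `R = M_{c′}∘𝔇₀ + 𝔇(M_{c′},M_c)∘X + Σ_μ [M_{a′_μ}∘𝔇_μ + 𝔇(M_{a′_μ},M_{a_μ})∘Y_μ]`, `𝔇_μ := 𝔇(Y′_μ, Y_μ)`;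
★★ `idef_firstOrder_jetGrad_fix`: with the jet readings `Y_μ = ∇_μ∘X`, `Y′_μ = ∇′_μ∘X′` (abstract `∇_μ = Dc μ`, `∇′_μ = Df μ`),
`𝔇_ν = 𝔇(∇′_νS′, ∇_νS) + 𝔇(∇′_νG′, ∇_νG)∘V + (∇′_νG′)∘R` — the SAME bracket, so `(𝔇₀, 𝔇_μ)_μ` solve ONE linear system whose coefficients are rows of `G′∘V₁′` and
`(∇′G′)∘(M_{c′} + ΣM_{a′})` and whose sources are the bare pairs' entry-0 AND entry-1 defects and the coefficient defects sandwiched between `G′` resp. `∇′G′` and the coarse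
jet; the derivative never meets a defect or a prolongation (source `S = G` for the dressed pair itself).  §2 ★ `idef_firstOrder_fix_src`: II-A's value-only identity
(jet read on the coarse grid only, fine side `X′ = S′ + G′∘V₁′∘X′` with `V₁′ = M_{c′} + ΣM_{a′_μ}∇′_μ`, transport law `∇′_μA′_μP = P∇_μ`) with a FREE source:
`𝔇₀ = 𝔇(S′,S) + 𝔇(G′,G)∘V + G′𝔇(M_{c′},M_c)X + Σ_μ[(G′M_{a′_μ}∇′_μ)(P − A′_μP)X + G′𝔇(M_{a′_μ},M_{a_μ})Y_μ] + (G′V₁′)𝔇₀` — at `S := G∘∇♯`, `X := W = X∘∇♯`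
this is entry 2 (`rightDeriv_fix`, `rightDeriv_fix'`, `jet_comp_rightDeriv` supply W's fixed points and jet from X's).
HONEST FRAMING.  [folklore] operator algebra; no estimate; King∕Bałaban objects not touched; nothing of [B5]∕[B6]∕[B9] asserted ((3.62)–(3.65) p.402 cited as MECHANISM);
NE2⁺ NOT printed ∕ proved; N15 NOT discharged; K3⁸ OPEN; counts UNMOVED (typed 28∕28 · discharged 5∕27); NOT ℝ⁴ ∕ OS ∕ mass gap ∕ Clay.  Restate-immune (no Theses import).
-/

open scoped BigOperators
open Finset

namespace Summit.QuantumFields.YangMills.BalabanUVNodes.N15.KingModel.JetDefect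

open Literature.MathematicalPhysics.QuantumFieldTheory.Balaban1983to89
open Literature.MathematicalPhysics.QuantumFieldTheory.Balaban1983to89.T4EtaRateDefect (idef idef_apply)
open Literature.MathematicalPhysics.QuantumFieldTheory.Balaban1983to89.T4EtaRateCoeffDefect (pull pull_apply)
open Literature.MathematicalPhysics.QuantumFieldTheory.Balaban1983to89.B6Prop26Gluing (mulOp mulOp_apply)

variable {X X' J : Type} [Fintype J] (π : X' → X)

/-! ## §1 The jet on both grids: the closed system for `(𝔇₀, 𝔇_μ)` -/

/-- ★ **THE VALUE DEFECT WITH THE JET KEPT ON BOTH GRIDS (free source).**  From the two jet-form fixed points `X = S + G∘(M_cX + Σ_μ M_{a_μ}Y_μ)`,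
`X′ = S′ + G′∘(M_{c′}X′ + Σ_μ M_{a′_μ}Y′_μ)`:
`𝔇(X′,X) = 𝔇(S′,S) + 𝔇(G′,G)∘(M_cX + ΣM_{a_μ}Y_μ) + G′∘(M_{c′}𝔇(X′,X) + 𝔇(M_{c′},M_c)X + Σ_μ[M_{a′_μ}𝔇(Y′_μ,Y_μ) + 𝔇(M_{a′_μ},M_{a_μ})Y_μ])` — no transport law, no face term.
[folklore] [cite: Balaban1985BackgroundPropagators, (3.62)–(3.65) p.402 (mechanism: the dressed pair as a fixed point); Balaban1984PropagatorsII, (2.52)–(2.56) pp.232–233 (defect bookkeeping, shape)] -/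
theorem idef_firstOrder_jetValue_fix (S G Xv : (X → ℝ) →ₗ[ℝ] (X → ℝ)) (Y : J → (X → ℝ) →ₗ[ℝ] (X → ℝ)) (c : X → ℝ) (a : J → X → ℝ)
    (S' G' Xv' : (X' → ℝ) →ₗ[ℝ] (X' → ℝ)) (Y' : J → (X' → ℝ) →ₗ[ℝ] (X' → ℝ)) (c' : X' → ℝ) (a' : J → X' → ℝ)
    (hfix : Xv = S + G ∘ₗ (mulOp c ∘ₗ Xv + ∑ μ, mulOp (a μ) ∘ₗ Y μ))
    (hfix' : Xv' = S' + G' ∘ₗ (mulOp c' ∘ₗ Xv' + ∑ μ, mulOp (a' μ) ∘ₗ Y' μ)) :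
    idef (pull π) (pull π) Xv' Xv =
      idef (pull π) (pull π) S' S + idef (pull π) (pull π) G' G ∘ₗ (mulOp c ∘ₗ Xv + ∑ μ, mulOp (a μ) ∘ₗ Y μ)
        + G' ∘ₗ (mulOp c' ∘ₗ idef (pull π) (pull π) Xv' Xv + idef (pull π) (pull π) (mulOp c') (mulOp c) ∘ₗ Xv
            + ∑ μ, (mulOp (a' μ) ∘ₗ idef (pull π) (pull π) (Y' μ) (Y μ) + idef (pull π) (pull π) (mulOp (a' μ)) (mulOp (a μ)) ∘ₗ Y μ)) := by
  refine LinearMap.ext fun φ => ?_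
  have e1 := LinearMap.congr_fun hfix' (pull π φ)
  have e2 := congrArg (pull π) (LinearMap.congr_fun hfix φ)
  simp only [LinearMap.comp_apply, LinearMap.add_apply, LinearMap.sum_apply, idef_apply, map_add, map_sub, map_sum,
    Finset.sum_add_distrib, Finset.sum_sub_distrib] at e1 e2 ⊢
  nth_rw 1 [e1]
  nth_rw 1 [e2]
  abel

/-- ★★ **THE GRADIENT DEFECTS — SAME BRACKET (free source).**  With the jet readings `Y_μ = ∇_μ∘X`, `Y′_μ = ∇′_μ∘X′` and the two fixed points
(`X′ = S′ + G′∘V₁′∘X′`, `V₁′ = M_{c′} + ΣM_{a′_μ}∇′_μ` — II-A's `hfix'` shape with a free source):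
`𝔇(∇′_νX′, ∇_νX) = 𝔇(∇′_νS′, ∇_νS) + 𝔇(∇′_νG′, ∇_νG)∘(M_cX + ΣM_{a_μ}Y_μ) + (∇′_νG′)∘(M_{c′}𝔇(X′,X) + 𝔇(M_{c′},M_c)X + Σ_μ[M_{a′_μ}𝔇(∇′_μX′,∇_μX) + 𝔇(M_{a′_μ},M_{a_μ})∇_μX])`
— with `idef_firstOrder_jetValue_fix` a CLOSED linear system in `(𝔇(X′,X), 𝔇(∇′_μX′,∇_μX))_μ`; the derivative always sits on `S′∕S` or `G′∕G`, never on a defect. [folklore]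
[cite: Balaban1985BackgroundPropagators, (3.62)–(3.65) p.402 (mechanism); Balaban1984PropagatorsI, Prop. 1.2 (1.110) p.35 (the «∇G» letter the coefficient rows consume)] -/
theorem idef_firstOrder_jetGrad_fix (S G Xv : (X → ℝ) →ₗ[ℝ] (X → ℝ)) (Y Dc : J → (X → ℝ) →ₗ[ℝ] (X → ℝ)) (c : X → ℝ) (a : J → X → ℝ)
    (S' G' Xv' : (X' → ℝ) →ₗ[ℝ] (X' → ℝ)) (Y' Df : J → (X' → ℝ) →ₗ[ℝ] (X' → ℝ)) (c' : X' → ℝ) (a' : J → X' → ℝ)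
    (hfix : Xv = S + G ∘ₗ (mulOp c ∘ₗ Xv + ∑ μ, mulOp (a μ) ∘ₗ Y μ))
    (hfix' : Xv' = S' + G' ∘ₗ ((mulOp c' + ∑ μ, mulOp (a' μ) ∘ₗ Df μ) ∘ₗ Xv'))
    (hY : ∀ μ, Y μ = Dc μ ∘ₗ Xv) (hY' : ∀ μ, Y' μ = Df μ ∘ₗ Xv') (ν : J) :
    idef (pull π) (pull π) (Y' ν) (Y ν) =
      idef (pull π) (pull π) (Df ν ∘ₗ S') (Dc ν ∘ₗ S) + idef (pull π) (pull π) (Df ν ∘ₗ G') (Dc ν ∘ₗ G) ∘ₗ (mulOp c ∘ₗ Xv + ∑ μ, mulOp (a μ) ∘ₗ Y μ)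
        + (Df ν ∘ₗ G') ∘ₗ (mulOp c' ∘ₗ idef (pull π) (pull π) Xv' Xv + idef (pull π) (pull π) (mulOp c') (mulOp c) ∘ₗ Xv
            + ∑ μ, (mulOp (a' μ) ∘ₗ idef (pull π) (pull π) (Y' μ) (Y μ) + idef (pull π) (pull π) (mulOp (a' μ)) (mulOp (a μ)) ∘ₗ Y μ)) := by
  refine LinearMap.ext fun φ => ?_
  have e1 : Y' ν (pull π φ) = Df ν (S' (pull π φ)) + Df ν (G' (mulOp c' (Xv' (pull π φ)) + ∑ μ, mulOp (a' μ) (Df μ (Xv' (pull π φ))))) := by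
    have h := LinearMap.congr_fun hfix' (pull π φ)
    simp only [LinearMap.comp_apply, LinearMap.add_apply, LinearMap.sum_apply] at h
    rw [hY', LinearMap.comp_apply]
    nth_rw 1 [h]
    rw [map_add]
  have e2 : pull π (Y ν φ) = pull π (Dc ν (S φ)) + pull π (Dc ν (G (mulOp c (Xv φ) + ∑ μ, mulOp (a μ) (Y μ φ)))) := by
    have h := LinearMap.congr_fun hfix φ
    simp only [LinearMap.comp_apply, LinearMap.add_apply, LinearMap.sum_apply] at h
    rw [hY, LinearMap.comp_apply]
    nth_rw 1 [h]
    rw [map_add, map_add]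
  have e3 : ∀ μ, Y' μ (pull π φ) = Df μ (Xv' (pull π φ)) := fun μ => by rw [hY', LinearMap.comp_apply]
  simp only [LinearMap.comp_apply, LinearMap.add_apply, LinearMap.sum_apply, idef_apply, map_add, map_sub, map_sum,
    Finset.sum_add_distrib, Finset.sum_sub_distrib]
  rw [e1, e2]
  simp only [e3, map_add, map_sum]
  abel

/-! ## §2 II-A's value-only identity with a free source (entry 2: the right-derivative pair) -/

/-- ★ **THE VALUE-ONLY FIXED POINT WITH A FREE SOURCE** (dag-n15-a II-A `idef_firstOrder_fix` is the case `S = G`, `S′ = G′`): coarse `X = S + G∘(M_cX + Σ_μ M_{a_μ}Y_μ)` with the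
jet reading `Y_μ = ∇_μ∘X`, fine `X′ = S′ + G′∘V₁′∘X′` (`V₁′ = M_{c′} + Σ_μ M_{a′_μ}∇′_μ`), prolongation `P = pull π`, box filters `A′_μ` with the transport law `∇′_μ∘A′_μ∘P = P∘∇_μ`;
then `𝔇₀ = 𝔇(X′,X)` satisfies `𝔇₀ = 𝔇(S′,S) + 𝔇(G′,G)∘(M_cX + ΣM_{a_μ}Y_μ) + G′𝔇(M_{c′},M_c)X + Σ_μ[(G′M_{a′_μ}∇′_μ)(P − A′_μP)X + G′𝔇(M_{a′_μ},M_{a_μ})Y_μ] + (G′V₁′)𝔇₀`.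
At `S := G∘∇♯`, `S′ := G′∘∇′♯`, `X := X∘∇♯` (see `rightDeriv_fix'`, `jet_comp_rightDeriv`) this is ENTRY 2 of the dressed pair. [folklore]
[cite: Balaban1985BackgroundPropagators, (3.62)–(3.65) p.402 (mechanism); King1986, (2.13)–(2.14) p.653 (block means ∕ prolongation convention)] -/
theorem idef_firstOrder_fix_src (S G Xv : (X → ℝ) →ₗ[ℝ] (X → ℝ)) (Y Dc : J → (X → ℝ) →ₗ[ℝ] (X → ℝ)) (c : X → ℝ) (a : J → X → ℝ)
    (S' G' Xv' : (X' → ℝ) →ₗ[ℝ] (X' → ℝ)) (Df Af : J → (X' → ℝ) →ₗ[ℝ] (X' → ℝ)) (c' : X' → ℝ) (a' : J → X' → ℝ)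
    (hfix : Xv = S + G ∘ₗ (mulOp c ∘ₗ Xv + ∑ μ, mulOp (a μ) ∘ₗ Y μ))
    (hfix' : Xv' = S' + G' ∘ₗ ((mulOp c' + ∑ μ, mulOp (a' μ) ∘ₗ Df μ) ∘ₗ Xv'))
    (hY : ∀ μ, Y μ = Dc μ ∘ₗ Xv) (hPA : ∀ μ, Df μ ∘ₗ (Af μ ∘ₗ pull π) = pull π ∘ₗ Dc μ) :
    idef (pull π) (pull π) Xv' Xv =
      idef (pull π) (pull π) S' S + idef (pull π) (pull π) G' G ∘ₗ (mulOp c ∘ₗ Xv + ∑ μ, mulOp (a μ) ∘ₗ Y μ)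
        + G' ∘ₗ (idef (pull π) (pull π) (mulOp c') (mulOp c) ∘ₗ Xv)
        + ∑ μ, ((G' ∘ₗ (mulOp (a' μ) ∘ₗ Df μ)) ∘ₗ ((pull π - Af μ ∘ₗ pull π) ∘ₗ Xv) + G' ∘ₗ (idef (pull π) (pull π) (mulOp (a' μ)) (mulOp (a μ)) ∘ₗ Y μ))
        + (G' ∘ₗ (mulOp c' + ∑ μ, mulOp (a' μ) ∘ₗ Df μ)) ∘ₗ idef (pull π) (pull π) Xv' Xv := by
  refine LinearMap.ext fun φ => ?_
  have e1 := LinearMap.congr_fun hfix' (pull π φ)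
  have e2 := congrArg (pull π) (LinearMap.congr_fun hfix φ)
  have e4 : ∀ μ, Df μ (Af μ (pull π (Xv φ))) = pull π (Dc μ (Xv φ)) := fun μ => by
    have e := LinearMap.congr_fun (hPA μ) (Xv φ)
    simpa only [LinearMap.comp_apply] using e
  simp only [hY] at e2 ⊢
  simp only [LinearMap.comp_apply, LinearMap.add_apply, LinearMap.sub_apply, LinearMap.sum_apply, idef_apply, map_add, map_sub, map_sum,
    Finset.sum_add_distrib, Finset.sum_sub_distrib] at e1 e2 ⊢
  nth_rw 1 [e1]
  nth_rw 1 [e2]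
  simp only [e4]
  abel

/-- **THE RIGHT-DERIVATIVE PAIR's FIXED POINT, jet form**: if `X = G + G∘(M_cX + ΣM_{a_μ}Y_μ)` then `X∘E = G∘E + G∘(M_c(X∘E) + ΣM_{a_μ}(Y_μ∘E))` for every right factor `E`
(a difference quotient `∇_ν` or its adjoint) — `idef_firstOrder_jetValue_fix`'s coarse hypothesis at source `S := G∘E`. [folklore] -/
theorem rightDeriv_fix {F : Type} [AddCommGroup F] [Module ℝ F] (G Xv : (X → ℝ) →ₗ[ℝ] (X → ℝ)) (Y : J → (X → ℝ) →ₗ[ℝ] (X → ℝ)) (c : X → ℝ) (a : J → X → ℝ)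
    (E : F →ₗ[ℝ] (X → ℝ)) (hfix : Xv = G + G ∘ₗ (mulOp c ∘ₗ Xv + ∑ μ, mulOp (a μ) ∘ₗ Y μ)) :
    Xv ∘ₗ E = G ∘ₗ E + G ∘ₗ (mulOp c ∘ₗ (Xv ∘ₗ E) + ∑ μ, mulOp (a μ) ∘ₗ (Y μ ∘ₗ E)) := by
  refine LinearMap.ext fun φ => ?_
  have h := LinearMap.congr_fun hfix (E φ)
  simp only [LinearMap.comp_apply, LinearMap.add_apply, LinearMap.sum_apply] at h ⊢
  exact h

/-- **THE RIGHT-DERIVATIVE PAIR's FIXED POINT, operator form** (the fine side of `idef_firstOrder_fix_src`): if `X′ = G′ + G′∘V₁′∘X′` then `X′∘E′ = G′∘E′ + G′∘V₁′∘(X′∘E′)`. [folklore] -/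
theorem rightDeriv_fix' {F : Type} [AddCommGroup F] [Module ℝ F] (G' Xv' V' : (X' → ℝ) →ₗ[ℝ] (X' → ℝ)) (E' : F →ₗ[ℝ] (X' → ℝ))
    (hfix' : Xv' = G' + G' ∘ₗ V' ∘ₗ Xv') : Xv' ∘ₗ E' = G' ∘ₗ E' + G' ∘ₗ V' ∘ₗ (Xv' ∘ₗ E') := by
  nth_rw 1 [hfix']
  simp only [LinearMap.add_comp, LinearMap.comp_assoc]

/-- The jet carried by the right-derivative pair: if `Y_μ = ∇_μ∘X` then `Y_μ∘E = ∇_μ∘(X∘E)` — so the coarse DRESSED mixed operator `∇X∇♯` is read off the same fixed point and is only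
ever needed UNDIFFERENCED (the row `K` of dag-n15-a II-B `hasMaj_pull_sub_sA_pull_comp` at `T := X∘∇♯`). [folklore] -/
theorem jet_comp_rightDeriv {F : Type} [AddCommGroup F] [Module ℝ F] (Xv Y D : (X → ℝ) →ₗ[ℝ] (X → ℝ)) (E : F →ₗ[ℝ] (X → ℝ))
    (hY : Y = D ∘ₗ Xv) : Y ∘ₗ E = D ∘ₗ (Xv ∘ₗ E) := by
  rw [hY, LinearMap.comp_assoc]

end Summit.QuantumFields.YangMills.BalabanUVNodes.N15.KingModel.JetDefect
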